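import Literature.Probability.LatticeModels.GaussianFieldReflectionPositivity
import HarnessLib

/-!
# Reflection positivity of a Gaussian lattice field FROM ITS PRECISION: ferromagnetic coupling across the cut

Theorem-only file (no definitions, no named facts).  Glimm–Jaffe prove reflection positivity of the free covariance `C = (−Δ_B + 1)⁻¹`
about a hyperplane (and about a cross-section dividing a torus in two equal parts) through the even∕odd decomposition `P_± = ½(1 ± θ)` and
a monotonicity of quadratic forms (*Quantum Physics* §7.10, Thm. 7.10.1–7.10.2), and state that «the lattice analogs of Theorems 7.10.1 and
7.10.2 hold» (Thm. 7.10.3: the lattice `ℤ^d` or the finite periodic lattice `ℤ^d_n`).  Fröhlich–Israel–Lieb–Simon's Thm. 2.1 gives the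
general mechanism: a Boltzmann weight `exp(B + θB + Σ_i C_i θC_i)` is reflection positive — for a Gaussian weight `exp(−½⟨φ,Aφ⟩)` this is the
statement that the coupling ACROSS THE CUT, `−Σ_{x,y∈P} φ_x A(x,θy) φ_{θy}`, is a positive-semidefinite form (a «ferromagnetic» coupling of the
half `P` to its mirror image).

THIS FILE proves that lattice statement in finite dimensions, in the form the tree's Gaussian reflection-positivity theorem consumes.  Setting: a
finite index set `V`, a real positive-definite matrix `A` (the PRECISION; covariance `A⁻¹`), an involution `θ : V ≃ V` leaving `A` invariant
(`A(θx,θy) = A(x,y)`) and SWAPPING a half `P ⊆ V` with its complement (`θx ∈ P ↔ x ∉ P`; a reflection between sites).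
* ★★★ `reflectedCovariance_nonneg_of_precision`: IF `Σ_{x,y} w_x A(x,θy) w_y ≤ 0` for every `w` supported in `P`, THEN
  `0 ≤ Σ_{x,y} u_x A⁻¹(x,θy) u_y` for every `u` supported in `P` (Glimm–Jaffe Def. 7.10.2 `0 ≤ Π₊θCΠ₊`).  PROOF (the even∕odd split of the proof
  of Thm. 7.10.1, made elementary): with `Θu = u∘θ`, `u_± = u ± Θu`, one has `4⟨u, CΘu⟩ = ⟨u₊,Cu₊⟩ − ⟨u₋,Cu₋⟩`; put `v = Cu₋` (θ-odd), `w = 𝟙_P v`,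
  `ṽ = w + Θw` (θ-even); the variational inequality `⟨a,Ca⟩ ≥ 2⟨a,ṽ⟩ − ⟨ṽ,Aṽ⟩` at `a = u₊`, the identities `⟨u₊,ṽ⟩ = ⟨u₋,v⟩`,
  `⟨ṽ,Aṽ⟩ − ⟨v,Av⟩ = 4⟨w,AΘw⟩ ≤ 0` (the cut hypothesis, used twice) and `⟨u₋,Cu₋⟩ = 2⟨u₋,v⟩ − ⟨v,Av⟩` give `⟨u₊,Cu₊⟩ ≥ ⟨u₋,Cu₋⟩`.
* ★★★ `reflectedCovariance_family_nonneg_of_precision`: the same along finite families `z_i ∈ P` with repetitions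
  (`0 ≤ Σ_{i,j} c_i c_j A⁻¹(θz_i, z_j)`) — exactly hypothesis `hRP` of `gaussianField_isReflectionPositive`.
* ★★★ `gaussianField_isReflectionPositive_of_precision`: hence `N(0, A⁻¹)` (the tree's `gaussianFieldOfKernel`) is REFLECTION POSITIVE ON ALL
  BOUNDED OBSERVABLES measurable in the coordinates in `P` (`IsReflectionPositive`, FILS 1978 §2 ∕ Biskup 2009 Def. 5.2), and reflection invariant.
* `cut_nonpos_of_nearestNeighbour`: the cut hypothesis holds when `A(x,θy) = 0` for `x ≠ y` in `P` and `A(x,θx) ≤ 0` on `P` — the case of a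
  nearest-neighbour precision `c(−Δ) + m²` and a reflection between sites (the only bonds crossing the cut join `x` to `θx`).

## References

* J. Glimm, A. Jaffe, *Quantum Physics. A Functional Integral Point of View* (2nd ed., Springer 1987), §7.10: Def. 7.10.1–7.10.2, Thm. 7.10.1
  (proof: `P_± = ½(I ± θ)`), Thm. 7.10.2 (torus), Thm. 7.10.3 (lattice analogs); §6.2 Thm. 6.2.2. [GlimmJaffe1987]
* J. Fröhlich, R. Israel, E. H. Lieb, B. Simon, *Phase transitions and reflection positivity. I*, Comm. Math. Phys. 62 (1978) 1–34, Thm. 2.1,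
  §3. [FILS1978]
* M. Biskup, *Reflection positivity and phase transitions in lattice spin models*, LNM 1970 (2009), §5.1 Def. 5.2, Lemma 5.6. [Biskup2009]
-/

noncomputable section

open Finset Matrix
open scoped BigOperators

universe u

namespace Literature.Probability.LatticeModels

open Literature.MathematicalPhysics.QuantumFieldTheory (IsPosSemidefKernel gaussianFieldOfKernel)

section PrecisionRP

variable {V : Type u} [Fintype V]

/-! ### Letters: an involution acting on vectors, invariance of `A` and `A⁻¹`, symmetry of the forms -/

/-- `⟨a∘θ, b∘θ⟩ = ⟨a, b⟩` for a bijection `θ`. [folklore] -/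
private theorem dotProduct_comp_equiv_eq (θ : V ≃ V) (a b : V → ℝ) :
    (fun x => a (θ x)) ⬝ᵥ (fun x => b (θ x)) = a ⬝ᵥ b := by
  simp only [dotProduct]
  exact Equiv.sum_comp θ (fun x => a x * b x)

/-- For a `θ`-invariant matrix and an involution `θ`: `(A(a∘θ))(θx) = (Aa)(x)`. [cite: GlimmJaffe1987, §7.10 Def. 7.10.1 (`[θ, C] = 0`)] -/
theorem mulVec_comp_equiv_of_invariant {A : Matrix V V ℝ} {θ : V ≃ V} (hθ : Function.Involutive θ)
    (hθA : ∀ x y, A (θ x) (θ y) = A x y) (a : V → ℝ) (x : V) :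
    (A *ᵥ fun y => a (θ y)) (θ x) = (A *ᵥ a) x := by
  simp only [mulVec, dotProduct]
  calc ∑ y, A (θ x) y * a (θ y) = ∑ y, A (θ x) (θ y) * a (θ (θ y)) :=
        (Equiv.sum_comp θ (fun y => A (θ x) y * a (θ y))).symm
    _ = ∑ y, A x y * a y := Finset.sum_congr rfl fun y _ => by rw [hθA, hθ y]

/-- For a `θ`-invariant matrix and an involution `θ`: `A(a∘θ) = (Aa)∘θ`. [cite: GlimmJaffe1987, §7.10 Def. 7.10.1] -/
theorem mulVec_comp_equiv_eq {A : Matrix V V ℝ} {θ : V ≃ V} (hθ : Function.Involutive θ)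
    (hθA : ∀ x y, A (θ x) (θ y) = A x y) (a : V → ℝ) :
    (A *ᵥ fun y => a (θ y)) = fun x => (A *ᵥ a) (θ x) := by
  funext x
  have h := mulVec_comp_equiv_of_invariant hθ hθA a (θ x)
  rwa [hθ x] at h

/-- `⟨a∘θ, A(b∘θ)⟩ = ⟨a, Ab⟩` for a `θ`-invariant matrix and an involution `θ`. [cite: GlimmJaffe1987, §7.10 Def. 7.10.1] -/
theorem dotProduct_mulVec_comp_equiv {A : Matrix V V ℝ} {θ : V ≃ V} (hθ : Function.Involutive θ)
    (hθA : ∀ x y, A (θ x) (θ y) = A x y) (a b : V → ℝ) :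
    (fun x => a (θ x)) ⬝ᵥ (A *ᵥ fun y => b (θ y)) = a ⬝ᵥ (A *ᵥ b) := by
  rw [mulVec_comp_equiv_eq hθ hθA b]
  exact dotProduct_comp_equiv_eq θ a (A *ᵥ b)

/-- The inverse of a `θ`-invariant matrix is `θ`-invariant. [cite: GlimmJaffe1987, §7.10 Def. 7.10.1] -/
theorem inv_apply_equiv_of_invariant [DecidableEq V] {A : Matrix V V ℝ} (θ : V ≃ V) (hθA : ∀ x y, A (θ x) (θ y) = A x y) (x y : V) :
    A⁻¹ (θ x) (θ y) = A⁻¹ x y := by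
  have hsub : A.submatrix θ θ = A := by
    ext i j
    exact hθA i j
  have h := Matrix.inv_submatrix_equiv A θ θ
  rw [hsub] at h
  have h' := congr_fun (congr_fun h x) y
  rw [Matrix.submatrix_apply] at h'
  exact h'.symm

omit [Fintype V] in
/-- Over `ℝ` a positive-definite matrix is symmetric. [folklore] -/
private theorem transpose_eq_of_posDef {A : Matrix V V ℝ} (hA : A.PosDef) : Aᵀ = A := by
  have h : Aᴴ = A := hA.isHermitian
  rwa [Matrix.conjTranspose_eq_transpose_of_trivial] at h

/-- The form of a symmetric matrix is symmetric: `⟨p, Aq⟩ = ⟨q, Ap⟩`. [folklore] -/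
private theorem dotProduct_mulVec_comm_of_transpose {A : Matrix V V ℝ} (hAt : Aᵀ = A) (p q : V → ℝ) :
    p ⬝ᵥ (A *ᵥ q) = q ⬝ᵥ (A *ᵥ p) := by
  rw [Matrix.dotProduct_mulVec, ← Matrix.mulVec_transpose, hAt, dotProduct_comm]

/-! ### The variational inequality `⟨a, A⁻¹a⟩ ≥ 2⟨a, v⟩ − ⟨v, Av⟩` -/

/-- **The variational inequality of a positive-definite form**: `2⟨a,v⟩ − ⟨v,Av⟩ ≤ ⟨a,A⁻¹a⟩` for all `v` (equality at `v = A⁻¹a`): expand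
`0 ≤ ⟨v − A⁻¹a, A(v − A⁻¹a)⟩`. [cite: GlimmJaffe1987, §7.10 Thm. 7.10.1 (proof: `C_D ≤ C` as forms)] -/
theorem two_mul_dotProduct_sub_le_dotProduct_inv_mulVec [DecidableEq V] {A : Matrix V V ℝ} (hA : A.PosDef) (a v : V → ℝ) :
    2 * (a ⬝ᵥ v) - v ⬝ᵥ (A *ᵥ v) ≤ a ⬝ᵥ (A⁻¹ *ᵥ a) := by
  have hAt : Aᵀ = A := transpose_eq_of_posDef hA
  have hdet : IsUnit A.det := (Matrix.isUnit_iff_isUnit_det _).mp hA.isUnit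
  set w : V → ℝ := A⁻¹ *ᵥ a with hw
  have hAw : A *ᵥ w = a := by
    rw [hw, Matrix.mulVec_mulVec, Matrix.mul_nonsing_inv _ hdet, Matrix.one_mulVec]
  have h0 : 0 ≤ (v - w) ⬝ᵥ (A *ᵥ (v - w)) := by
    have := hA.posSemidef.dotProduct_mulVec_nonneg (v - w)
    rwa [star_trivial] at this
  have h1 : (v - w) ⬝ᵥ (A *ᵥ (v - w)) = v ⬝ᵥ (A *ᵥ v) - 2 * (a ⬝ᵥ v) + a ⬝ᵥ w := by
    have hwv : w ⬝ᵥ (A *ᵥ v) = a ⬝ᵥ v := by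
      rw [dotProduct_mulVec_comm_of_transpose hAt, hAw, dotProduct_comm]
    rw [Matrix.mulVec_sub, hAw, sub_dotProduct, dotProduct_sub, dotProduct_sub, hwv, dotProduct_comm v a,
      dotProduct_comm w a]
    ring
  rw [h1] at h0
  linarith

/-! ### The theorem: reflected covariance Gram ≥ 0 from a ferromagnetic cut coupling -/

/-- `Σ_{x,y} u_x K(x,θy) u′_y = ⟨u, K(u′∘θ)⟩` for an involution `θ`. [folklore] -/
private theorem sum_sum_mul_reflect_eq_dotProduct (K : Matrix V V ℝ) {θ : V ≃ V} (hθ : Function.Involutive θ) (u u' : V → ℝ) :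
    ∑ x, ∑ y, u x * K x (θ y) * u' y = u ⬝ᵥ (K *ᵥ fun y => u' (θ y)) := by
  simp only [dotProduct, mulVec, Finset.mul_sum]
  refine Finset.sum_congr rfl fun x _ => ?_
  calc ∑ y, u x * K x (θ y) * u' y = ∑ y, u x * K x (θ (θ y)) * u' (θ y) :=
        (Equiv.sum_comp θ (fun y => u x * K x (θ y) * u' y)).symm
    _ = ∑ y, u x * (K x y * u' (θ y)) := Finset.sum_congr rfl fun y _ => by rw [hθ y]; ring

/-- ★★★ **REFLECTION POSITIVITY OF THE COVARIANCE FROM THE PRECISION** (Glimm–Jaffe §7.10, lattice form; FILS Thm. 2.1 for Gaussian weights): let `A`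
be a real positive-definite matrix on a finite set `V`, `θ` an involution of `V` leaving `A` invariant and swapping the half `P` with its complement.
If the coupling across the cut is ferromagnetic — `Σ_{x,y} w_x A(x,θy) w_y ≤ 0` for every `w` supported in `P` — then the covariance `A⁻¹` is
reflection positive on `P`: `0 ≤ Σ_{x,y} u_x A⁻¹(x,θy) u_y` for every `u` supported in `P` (`0 ≤ Π₊θCΠ₊`, Def. 7.10.2).
[cite: GlimmJaffe1987, §7.10 Def. 7.10.2, Thm. 7.10.1 (proof), Thm. 7.10.3] [cite: FILS1978, Thm. 2.1] -/
theorem reflectedCovariance_nonneg_of_precision [DecidableEq V] {A : Matrix V V ℝ} (hA : A.PosDef) {θ : V ≃ V} (hθ : Function.Involutive θ)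
    (hθA : ∀ x y, A (θ x) (θ y) = A x y) {P : Set V} (hP : ∀ x, θ x ∈ P ↔ x ∉ P)
    (hcut : ∀ w : V → ℝ, (∀ x, x ∉ P → w x = 0) → ∑ x, ∑ y, w x * A x (θ y) * w y ≤ 0)
    (u : V → ℝ) (hu : ∀ x, x ∉ P → u x = 0) :
    0 ≤ ∑ x, ∑ y, u x * A⁻¹ x (θ y) * u y := by
  classical
  have hAt : Aᵀ = A := transpose_eq_of_posDef hA
  have hdet : IsUnit A.det := (Matrix.isUnit_iff_isUnit_det _).mp hA.isUnit
  set C : Matrix V V ℝ := A⁻¹ with hCdef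
  have hCt : Cᵀ = C := by rw [hCdef, Matrix.transpose_nonsing_inv, hAt]
  have hθC : ∀ x y, C (θ x) (θ y) = C x y := inv_apply_equiv_of_invariant θ hθA
  -- the involution on vectors
  let R : (V → ℝ) → (V → ℝ) := fun a x => a (θ x)
  have hR : ∀ a x, R a x = a (θ x) := fun a x => rfl
  have hRR : ∀ a, R (R a) = a := fun a => funext fun x => by
    show a (θ (θ x)) = a x
    rw [hθ x]
  have hdotRR : ∀ a b, R a ⬝ᵥ R b = a ⬝ᵥ b := fun a b => dotProduct_comp_equiv_eq θ a b
  have hdotR : ∀ a b, R a ⬝ᵥ b = a ⬝ᵥ R b := fun a b => by rw [← hdotRR (R a) b, hRR]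
  have hCR : ∀ a, C *ᵥ R a = R (C *ᵥ a) := fun a => mulVec_comp_equiv_eq hθ hθC a
  have hformAR : ∀ a b, R a ⬝ᵥ (A *ᵥ R b) = a ⬝ᵥ (A *ᵥ b) := fun a b => dotProduct_mulVec_comp_equiv hθ hθA a b
  have hformCR : ∀ a b, R a ⬝ᵥ (C *ᵥ R b) = a ⬝ᵥ (C *ᵥ b) := fun a b => dotProduct_mulVec_comp_equiv hθ hθC a b
  have hsymA : ∀ p q, p ⬝ᵥ (A *ᵥ q) = q ⬝ᵥ (A *ᵥ p) := dotProduct_mulVec_comm_of_transpose hAt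
  have hsymC : ∀ p q, p ⬝ᵥ (C *ᵥ q) = q ⬝ᵥ (C *ᵥ p) := dotProduct_mulVec_comm_of_transpose hCt
  -- the target as a form
  rw [sum_sum_mul_reflect_eq_dotProduct C hθ u u]
  change 0 ≤ u ⬝ᵥ (C *ᵥ R u)
  -- even / odd parts
  set up : V → ℝ := u + R u with hup
  set um : V → ℝ := u - R u with hum
  have hRum : R um = -um := by
    funext x
    simp only [hum, hR, Pi.sub_apply, Pi.neg_apply, hθ x]
    ring
  have hG : up ⬝ᵥ (C *ᵥ up) - um ⬝ᵥ (C *ᵥ um) = 4 * (u ⬝ᵥ (C *ᵥ R u)) := by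
    have e1 : R u ⬝ᵥ (C *ᵥ R u) = u ⬝ᵥ (C *ᵥ u) := hformCR u u
    have e2 : R u ⬝ᵥ (C *ᵥ u) = u ⬝ᵥ (C *ᵥ R u) := by rw [hsymC]
    simp only [hup, hum, Matrix.mulVec_add, Matrix.mulVec_sub, add_dotProduct, sub_dotProduct, dotProduct_add,
      dotProduct_sub, e1, e2]
    ring
  -- it suffices to compare the even and odd forms
  suffices hmain : um ⬝ᵥ (C *ᵥ um) ≤ up ⬝ᵥ (C *ᵥ up) by linarith
  -- `v = C u₋` is θ-odd; `w = 𝟙_P v`; `v = w − Rw`; `ṽ = w + Rw`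
  set v : V → ℝ := C *ᵥ um with hv
  have hRv : R v = -v := by rw [hv, ← hCR, hRum, Matrix.mulVec_neg]
  set w : V → ℝ := fun x => if x ∈ P then v x else 0 with hw
  have hw_off : ∀ x, x ∉ P → w x = 0 := fun x hx => by simp only [hw, hx, if_false]
  have hvw : v = w - R w := by
    funext x
    by_cases hx : x ∈ P
    · have hθx : θ x ∉ P := fun h => ((hP x).mp h) hx
      simp only [hw, hR, Pi.sub_apply, hx, if_true, hθx, if_false, sub_zero]
    · have hθx : θ x ∈ P := (hP x).mpr hx
      have hvx : v x = -v (θ x) := by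
        have := congr_fun hRv x
        rw [hR, Pi.neg_apply] at this
        linarith
      simp only [hw, hR, Pi.sub_apply, hx, if_false, hθx, if_true, zero_sub, hvx]
  set vt : V → ℝ := w + R w with hvt
  -- Claim 1: `⟨u₊, ṽ⟩ = ⟨u₋, v⟩ (= 2⟨u, w⟩)`
  have huRw : u ⬝ᵥ R w = 0 := by
    simp only [dotProduct]
    refine Finset.sum_eq_zero fun x _ => ?_
    by_cases hx : x ∈ P
    · have hθx : θ x ∉ P := fun h => ((hP x).mp h) hx
      show u x * w (θ x) = 0
      rw [hw_off (θ x) hθx, mul_zero]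
    · show u x * w (θ x) = 0
      rw [hu x hx, zero_mul]
  have hRuw : R u ⬝ᵥ w = 0 := by
    rw [hdotR]
    exact huRw
  have hclaim1 : up ⬝ᵥ vt = um ⬝ᵥ v := by
    rw [hvw]
    simp only [hup, hum, hvt, add_dotProduct, sub_dotProduct, dotProduct_add, dotProduct_sub, huRw, hRuw, hdotRR]
    ring
  -- Claim 2: `⟨ṽ, Aṽ⟩ − ⟨v, Av⟩ = 4⟨w, A Rw⟩ ≤ 0`
  have hcutw : w ⬝ᵥ (A *ᵥ R w) ≤ 0 := by
    have h := hcut w hw_off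
    rwa [sum_sum_mul_reflect_eq_dotProduct A hθ w w] at h
  have hvtA : vt ⬝ᵥ (A *ᵥ vt) = 2 * (w ⬝ᵥ (A *ᵥ w)) + 2 * (w ⬝ᵥ (A *ᵥ R w)) := by
    have e1 : R w ⬝ᵥ (A *ᵥ R w) = w ⬝ᵥ (A *ᵥ w) := hformAR w w
    have e2 : R w ⬝ᵥ (A *ᵥ w) = w ⬝ᵥ (A *ᵥ R w) := by rw [hsymA]
    simp only [hvt, Matrix.mulVec_add, add_dotProduct, dotProduct_add, e1, e2]
    ring
  have hvA : v ⬝ᵥ (A *ᵥ v) = 2 * (w ⬝ᵥ (A *ᵥ w)) - 2 * (w ⬝ᵥ (A *ᵥ R w)) := by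
    have e1 : R w ⬝ᵥ (A *ᵥ R w) = w ⬝ᵥ (A *ᵥ w) := hformAR w w
    have e2 : R w ⬝ᵥ (A *ᵥ w) = w ⬝ᵥ (A *ᵥ R w) := by rw [hsymA]
    rw [hvw]
    simp only [Matrix.mulVec_sub, sub_dotProduct, dotProduct_sub, e1, e2]
    ring
  -- `⟨u₋, Cu₋⟩ = ⟨u₋, v⟩ = 2⟨u₋,v⟩ − ⟨v,Av⟩`
  have humC : um ⬝ᵥ (C *ᵥ um) = um ⬝ᵥ v := by rw [hv]
  have hvAv : v ⬝ᵥ (A *ᵥ v) = um ⬝ᵥ v := by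
    have : A *ᵥ v = um := by
      rw [hv, Matrix.mulVec_mulVec, hCdef, Matrix.mul_nonsing_inv _ hdet, Matrix.one_mulVec]
    rw [this, dotProduct_comm]
  -- the variational inequality at `a = u₊`, `v = ṽ`
  have hVI := two_mul_dotProduct_sub_le_dotProduct_inv_mulVec hA up vt
  rw [← hCdef] at hVI
  rw [hclaim1, hvtA] at hVI
  calc um ⬝ᵥ (C *ᵥ um) = 2 * (um ⬝ᵥ v) - v ⬝ᵥ (A *ᵥ v) := by rw [humC, hvAv]; ring
    _ = 2 * (um ⬝ᵥ v) - (2 * (w ⬝ᵥ (A *ᵥ w)) - 2 * (w ⬝ᵥ (A *ᵥ R w))) := by rw [hvA]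
    _ ≤ 2 * (um ⬝ᵥ v) - (2 * (w ⬝ᵥ (A *ᵥ w)) + 2 * (w ⬝ᵥ (A *ᵥ R w))) := by linarith
    _ ≤ up ⬝ᵥ (C *ᵥ up) := hVI

/-- The same conclusion with the reflection on the FIRST argument: `0 ≤ Σ_{x,y} u_x A⁻¹(θx, y) u_y`. [cite: GlimmJaffe1987, §7.10 Def. 7.10.2, Thm. 7.10.3] -/
theorem reflectedCovariance_nonneg_of_precision' [DecidableEq V] {A : Matrix V V ℝ} (hA : A.PosDef) {θ : V ≃ V} (hθ : Function.Involutive θ)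
    (hθA : ∀ x y, A (θ x) (θ y) = A x y) {P : Set V} (hP : ∀ x, θ x ∈ P ↔ x ∉ P)
    (hcut : ∀ w : V → ℝ, (∀ x, x ∉ P → w x = 0) → ∑ x, ∑ y, w x * A x (θ y) * w y ≤ 0)
    (u : V → ℝ) (hu : ∀ x, x ∉ P → u x = 0) :
    0 ≤ ∑ x, ∑ y, u x * A⁻¹ (θ x) y * u y := by
  have h := reflectedCovariance_nonneg_of_precision hA hθ hθA hP hcut u hu
  refine h.trans_eq (Finset.sum_congr rfl fun x _ => Finset.sum_congr rfl fun y _ => ?_)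
  rw [← inv_apply_equiv_of_invariant θ hθA x (θ y), hθ y]

/-! ### Families with repetitions; the nearest-neighbour sufficient condition -/

/-- Re-indexing a family double sum by the fibres of the point map: `Σ_{i,j∈s} c_i c_j F(z_i,z_j) = Σ_{x,y} (Σ_{z_i=x} c_i) F(x,y) (Σ_{z_j=y} c_j)`.
[folklore] -/
private theorem sum_sum_mul_mul_eq_fiber [DecidableEq V] (F : V → V → ℝ) {ι : Type*} (s : Finset ι) (c : ι → ℝ) (z : ι → V) :
    ∑ i ∈ s, ∑ j ∈ s, c i * c j * F (z i) (z j)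
      = ∑ x, ∑ y, (∑ i ∈ s with z i = x, c i) * F x y * (∑ j ∈ s with z j = y, c j) := by
  have inner : ∀ i, ∑ j ∈ s, c i * c j * F (z i) (z j) = ∑ y, c i * F (z i) y * ∑ j ∈ s with z j = y, c j := by
    intro i
    rw [← Finset.sum_fiberwise s z (fun j => c i * c j * F (z i) (z j))]
    refine Finset.sum_congr rfl fun y _ => ?_
    rw [Finset.mul_sum]
    refine Finset.sum_congr rfl fun j hj => ?_
    rw [(Finset.mem_filter.1 hj).2]
    ring
  rw [Finset.sum_congr rfl fun i _ => inner i,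
    ← Finset.sum_fiberwise s z (fun i => ∑ y, c i * F (z i) y * ∑ j ∈ s with z j = y, c j)]
  refine Finset.sum_congr rfl fun x _ => ?_
  rw [Finset.sum_comm]
  refine Finset.sum_congr rfl fun y _ => ?_
  rw [Finset.sum_mul, Finset.sum_mul]
  refine Finset.sum_congr rfl fun i hi => ?_
  rw [(Finset.mem_filter.1 hi).2]

/-- ★★★ **THE FAMILY FORM** (hypothesis `hRP` of `gaussianField_isReflectionPositive`): under the hypotheses of
`reflectedCovariance_nonneg_of_precision`, `0 ≤ Σ_{i,j∈s} c_i c_j A⁻¹(θz_i, z_j)` for every finite family `z_i ∈ P` (repetitions allowed).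
[cite: GlimmJaffe1987, §7.10 Def. 7.10.2, Thm. 7.10.3] [cite: FILS1978, Thm. 2.1] -/
theorem reflectedCovariance_family_nonneg_of_precision [DecidableEq V] {A : Matrix V V ℝ} (hA : A.PosDef) {θ : V ≃ V} (hθ : Function.Involutive θ)
    (hθA : ∀ x y, A (θ x) (θ y) = A x y) {P : Set V} (hP : ∀ x, θ x ∈ P ↔ x ∉ P)
    (hcut : ∀ w : V → ℝ, (∀ x, x ∉ P → w x = 0) → ∑ x, ∑ y, w x * A x (θ y) * w y ≤ 0)
    (ι : Type u) (s : Finset ι) (c : ι → ℝ) (z : ι → V) (hz : ∀ i ∈ s, z i ∈ P) :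
    0 ≤ ∑ i ∈ s, ∑ j ∈ s, c i * c j * A⁻¹ (θ (z i)) (z j) := by
  classical
  rw [sum_sum_mul_mul_eq_fiber (fun x y => A⁻¹ (θ x) y) s c z]
  set u : V → ℝ := fun x => ∑ i ∈ s with z i = x, c i with hu
  have hu0 : ∀ x, x ∉ P → u x = 0 := fun x hx => by
    rw [hu]
    refine Finset.sum_eq_zero fun i hi => ?_
    exfalso
    obtain ⟨hi1, hi2⟩ := Finset.mem_filter.1 hi
    exact hx (hi2 ▸ hz i hi1)
  have h := reflectedCovariance_nonneg_of_precision' hA hθ hθA hP hcut u hu0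
  refine h.trans_eq (Finset.sum_congr rfl fun x _ => Finset.sum_congr rfl fun y _ => ?_)
  simp only [hu]

/-- `A⁻¹` of a real positive-definite `A` is a positive-semidefinite kernel (all Gram matrices PSD) — the covariance of `N(0, A⁻¹)`.
[cite: GlimmJaffe1987, §6.2 Thm. 6.2.2] -/
theorem isPosSemidefKernel_inv_of_posDef [DecidableEq V] {A : Matrix V V ℝ} (hA : A.PosDef) :
    IsPosSemidefKernel fun i j : V => A⁻¹ i j :=
  fun _ => hA.inv.posSemidef.submatrix _

/-- ★★★ **THE GAUSSIAN FIELD `N(0, A⁻¹)` IS REFLECTION POSITIVE ON ALL BOUNDED HALF-SPACE OBSERVABLES** when the precision `A` is positive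
definite, `θ`-invariant, and ferromagnetic across the cut of an involution `θ` swapping `P` with its complement: the tree's `IsReflectionPositive
(gaussianFieldOfKernel A⁻¹) θ P` (all bounded complex observables measurable in the coordinates in `P`; Glimm–Jaffe Thm. 6.2.2 + §7.10, FILS Thm. 2.1).
[cite: GlimmJaffe1987, §6.2 Thm. 6.2.2, §7.10 Thm. 7.10.3] [cite: FILS1978, Thm. 2.1] [cite: Biskup2009, §5.1 Def. 5.2, Lemma 5.6] -/
theorem gaussianField_isReflectionPositive_of_precision [DecidableEq V] {A : Matrix V V ℝ} (hA : A.PosDef) (θ : V ≃ V) (hθ : Function.Involutive θ)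
    (hθA : ∀ x y, A (θ x) (θ y) = A x y) {P : Set V} (hP : ∀ x, θ x ∈ P ↔ x ∉ P)
    (hcut : ∀ w : V → ℝ, (∀ x, x ∉ P → w x = 0) → ∑ x, ∑ y, w x * A x (θ y) * w y ≤ 0) :
    IsReflectionPositive (gaussianFieldOfKernel fun i j : V => A⁻¹ i j) θ P :=
  gaussianField_isReflectionPositive (isPosSemidefKernel_inv_of_posDef hA) θ (inv_apply_equiv_of_invariant θ hθA) hθ
    (reflectedCovariance_family_nonneg_of_precision hA hθ hθA hP hcut)

/-- The real form `IsReflectionPositiveReal` under the same hypotheses. [cite: GlimmJaffe1987, §7.10 Thm. 7.10.3] [cite: Biskup2009, §5.1 Def. 5.2] -/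
theorem gaussianField_isReflectionPositiveReal_of_precision [DecidableEq V] {A : Matrix V V ℝ} (hA : A.PosDef) (θ : V ≃ V) (hθ : Function.Involutive θ)
    (hθA : ∀ x y, A (θ x) (θ y) = A x y) {P : Set V} (hP : ∀ x, θ x ∈ P ↔ x ∉ P)
    (hcut : ∀ w : V → ℝ, (∀ x, x ∉ P → w x = 0) → ∑ x, ∑ y, w x * A x (θ y) * w y ≤ 0) :
    IsReflectionPositiveReal (gaussianFieldOfKernel fun i j : V => A⁻¹ i j) θ P :=
  (gaussianField_isReflectionPositive_of_precision hA θ hθ hθA hP hcut).real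

/-- `N(0, A⁻¹)` is invariant under the configuration reflection `σ ↦ σ∘θ` for a `θ`-invariant positive-definite precision.
[cite: GlimmJaffe1987, §6.2 Thm. 6.2.2] -/
theorem gaussianField_isReflectionInvariant_of_precision [DecidableEq V] {A : Matrix V V ℝ} (hA : A.PosDef) (θ : V ≃ V)
    (hθA : ∀ x y, A (θ x) (θ y) = A x y) :
    IsReflectionInvariant (gaussianFieldOfKernel fun i j : V => A⁻¹ i j) θ :=
  gaussianField_isReflectionInvariant (isPosSemidefKernel_inv_of_posDef hA) θ (inv_apply_equiv_of_invariant θ hθA)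

/-- **The nearest-neighbour sufficient condition for the cut hypothesis**: if the only entries of `A` across the cut within `P × θP` are the
diagonal ones `A(x,θx) ≤ 0` (`A(x,θy) = 0` for `x ≠ y` in `P`), then `Σ_{x,y} w_x A(x,θy) w_y = Σ_{x} A(x,θx) w_x² ≤ 0` for `w` supported in `P`
(a nearest-neighbour precision and a reflection between sites: every bond crossing the cut joins a site to its mirror image).
[cite: GlimmJaffe1987, §7.10 Thm. 7.10.3] [cite: FILS1978, §3 (nearest-neighbour interactions)] -/
theorem cut_nonpos_of_nearestNeighbour {A : Matrix V V ℝ} {θ : V ≃ V} {P : Set V}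
    (hoff : ∀ x ∈ P, ∀ y ∈ P, x ≠ y → A x (θ y) = 0) (hdiag : ∀ x ∈ P, A x (θ x) ≤ 0)
    (w : V → ℝ) (hw : ∀ x, x ∉ P → w x = 0) :
    ∑ x, ∑ y, w x * A x (θ y) * w y ≤ 0 := by
  classical
  have hrow : ∀ x, ∑ y, w x * A x (θ y) * w y = w x * A x (θ x) * w x := by
    intro x
    rw [Finset.sum_eq_single x]
    · intro y _ hyx
      by_cases hx : x ∈ P
      · by_cases hy : y ∈ P
        · rw [hoff x hx y hy (Ne.symm hyx), mul_zero, zero_mul]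
        · rw [hw y hy, mul_zero]
      · rw [hw x hx, zero_mul, zero_mul]
    · intro h; exact absurd (Finset.mem_univ x) h
  rw [Finset.sum_congr rfl fun x _ => hrow x]
  refine Finset.sum_nonpos fun x _ => ?_
  by_cases hx : x ∈ P
  · have : w x * A x (θ x) * w x = A x (θ x) * (w x * w x) := by ring
    rw [this]
    exact mul_nonpos_of_nonpos_of_nonneg (hdiag x hx) (mul_self_nonneg _)
  · rw [hw x hx, zero_mul, zero_mul]

end PrecisionRP

end Literature.Probability.LatticeModels
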